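import Literature.NumberTheory.DiophantineGeometry.MinimalDiscriminant
import Literature.NumberTheory.DiophantineGeometry.MinimalDiscriminantFiniteProofs
import HarnessLib

/-!
# The minimal discriminant of a Weierstrass curve — prime factorisation of `N (𝔇_min)` over `ℤ`

Discharge (D-0014) of the named fact `WeierstrassCurve.factorization_minimalDiscriminantNorm` of
`Literature.NumberTheory.DiophantineGeometry.MinimalDiscriminant`: for a Weierstrass curve `W / ℚ`
and a finite place `v` of `ℤ`, with `𝔭_v = (p_v)` (`p_v = Rat.HeightOneSpectrum.natGenerator v`),
the exponent of `p_v` in `N (𝔇_min) = |Δ_min| ∈ ℕ` is `ord_v (Δ_min)`: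

  `(W.minimalDiscriminantNorm ℤ).factorization p_v = W.ordMinimalDiscriminant v`,

i.e. `|Δ_min| = ∏_p p ^ ord_p (Δ_min)`.

Kept in its own sibling file, like `MinimalDiscriminantFiniteProofs` (whose discharge
`WeierstrassCurve.finite_setOf_ordMinimalDiscriminant_ne_zero_holds` is used here); the auxiliary
steps are `private`, so that this file cannot clash with the discharges of the neighbouring facts in
`MinimalDiscriminantProofs` / `MinimalDiscriminantSpanProofs` / `LocalReductionProofs`.

## Proof

This is the *definition* of the minimal discriminant — Silverman, AEC VIII.8, p. 243: "the
**minimal discriminant** of `E / K` … `𝒟_{E/K} = ∏_{v ∈ M_K⁰} 𝔭_v ^ {v(Δ_v)}`", where `Δ_v` is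
the discriminant of a minimal Weierstrass equation for `E` at `v` — unfolded over `A = ℤ`,
`K = ℚ`, where every `𝔭_v` is generated by a rational prime `p_v`:

1. The set `{v | ord_v (Δ_min) ≠ 0}` is finite. For `Δ ≠ 0` this is the named fact
   `finite_setOf_ordMinimalDiscriminant_ne_zero` (AEC VIII.1, Remark 1.3: for all but finitely
   many `v` the given equation is `v`-integral with `v (Δ) = 0`, hence already minimal at `v` by
   VII.1, Remark 1.1). For a singular `W` (`Δ = 0`) every exponent is the documented junk value
   `0`: the chosen local minimal model `C • W_v` has discriminant `u⁻¹² Δ (W_v) = 0`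
   (AEC III.1, Table 3.1), and `addVal 0 = ⊤`, `⊤.toNat = 0`.
2. Hence `𝔇_min = ∏ᶠ_v 𝔭_v ^ ord_v (Δ_min) = ∏_{v ∈ s} 𝔭_v ^ ord_v (Δ_min)` is a genuine finite
   product over any finite set `s` of places containing that support
   (`finprod_eq_prod_of_mulSupport_subset`).
3. `Ideal.absNorm` is multiplicative and `N ((p)) = p` over `ℤ` (`Ideal.absNorm_span_natCast`),
   so `N (𝔇_min) = ∏_{v ∈ s} p_v ^ ord_v (Δ_min)`.
4. Distinct places of `ℤ` have distinct primes (`Rat.HeightOneSpectrum.primesEquiv`), so reading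
   off the `p_v`-adic exponent of this product (`Nat.factorization_prod_apply`,
   `Nat.Prime.factorization_pow`) gives `ord_v (Δ_min)`.

All declarations live in `namespace WeierstrassCurve` (deliberate dot-notation extension of the
Mathlib namespace, as in the parent file).

## References

* J. H. Silverman, *The Arithmetic of Elliptic Curves*, GTM 106, 2nd ed. 2009: §VIII.8, p. 243
  (definition of the minimal discriminant `𝒟_{E/K}`); §VIII.1, Remark 1.3 and §VII.1, Remark 1.1
  (almost every `v` already has a minimal equation with `v (Δ) = 0`); §III.1, Table 3.1
  (`u¹² Δ' = Δ`). [SilvermanAEC2009]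
-/

open IsDedekindDomain

namespace WeierstrassCurve

section DVR

variable {R : Type*} [CommRing R] [IsDomain R] [IsDiscreteValuationRing R]
  {F : Type*} [Field F] [Algebra R F] [IsFractionRing R F]

/-- Over a discrete valuation ring `R` with fraction field `F`: if `Δ (X) = 0` then the integral
model of the chosen minimal model `X.minimal R = C • X` of `X` has `Δ = 0` as well, since the
discriminant transforms by `Δ (C • X) = u⁻¹² Δ (X)`. Silverman, AEC III.1, Table 3.1
(`u¹² Δ' = Δ`). [folklore] -/
private theorem Δ_integralModel_minimal_eq_zero (X : WeierstrassCurve F) (hX : X.Δ = 0) :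
    ((X.minimal R).integralModel R).Δ = 0 := by
  apply FaithfulSMul.algebraMap_injective R F
  rw [integralModel_Δ_eq, map_zero, minimal, variableChange_Δ, hX, mul_zero]

end DVR

section Dedekind

variable {A : Type*} [CommRing A] [IsDedekindDomain A] {K : Type*} [Field K]
  [Algebra A K] [IsFractionRing A K] (W : WeierstrassCurve K)

/-- Junk value: for a singular `W` (`Δ = 0`) every exponent `ord_v (Δ_min)` is `0`, because the
integral local minimal model at `v` has `Δ = 0` (`Δ` transforms by `u⁻¹²`, Silverman, AEC III.1,
Table 3.1), `IsDiscreteValuationRing.addVal 0 = ⊤` and `(⊤ : ℕ∞).toNat = 0` (the junk value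
documented on `WeierstrassCurve.ordMinimalDiscriminant`). [folklore] -/
private theorem ordMinimalDiscriminant_of_Δ_eq_zero (hW : W.Δ = 0) (v : HeightOneSpectrum A) :
    W.ordMinimalDiscriminant v = 0 := by
  change (IsDiscreteValuationRing.addVal _ ((((W.baseChange (v.adicCompletion K)).minimal
    (v.adicCompletionIntegers K)).integralModel (v.adicCompletionIntegers K)).Δ)).toNat = 0
  rw [Δ_integralModel_minimal_eq_zero _ (by rw [baseChange, map_Δ, hW, map_zero]),
    IsDiscreteValuationRing.addVal_zero, ENat.toNat_top]

/-- The set of finite places `v` with `ord_v (Δ_min) ≠ 0` is finite, with no ellipticity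
hypothesis: for `Δ ≠ 0` this is the named fact
`WeierstrassCurve.finite_setOf_ordMinimalDiscriminant_ne_zero` (discharged in
`MinimalDiscriminantFiniteProofs`; Silverman, AEC VIII.1, Remark 1.3 — for all but finitely many
`v` the given equation is already minimal with `v (Δ) = 0`), and for `Δ = 0` the set is empty by
the junk value `ord_v (Δ_min) = 0`. [cite: SilvermanAEC2009, VIII.1 Remark 1.3 and VIII.8] -/
private theorem finite_setOf_ordMinimalDiscriminant_ne_zero' :
    {v : HeightOneSpectrum A | W.ordMinimalDiscriminant v ≠ 0}.Finite := by
  by_cases hW : W.Δ = 0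
  · convert Set.finite_empty
    ext v
    simp [ordMinimalDiscriminant_of_Δ_eq_zero W hW v]
  · haveI : W.IsElliptic := ⟨isUnit_iff_ne_zero.mpr hW⟩
    exact finite_setOf_ordMinimalDiscriminant_ne_zero_holds (A := A) W

/-- The minimal discriminant ideal `𝔇_min = ∏ᶠ_v 𝔭_v ^ ord_v (Δ_min)` as a genuine finite
product `∏_{v ∈ s} 𝔭_v ^ ord_v (Δ_min)` over any finite set `s` of places containing those with
`ord_v (Δ_min) ≠ 0` (outside `s` the factors are `𝔭_v ^ 0 = 1`). Silverman, AEC VIII.8, p. 243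
(definition of `𝒟_{E/K}`). [cite: SilvermanAEC2009, VIII.8 (definition of the minimal discriminant, p. 243)] -/
private theorem minimalDiscriminantIdeal_eq_prod {s : Finset (HeightOneSpectrum A)}
    (hs : {v : HeightOneSpectrum A | W.ordMinimalDiscriminant v ≠ 0} ⊆ s) :
    W.minimalDiscriminantIdeal A = ∏ v ∈ s, v.asIdeal ^ W.ordMinimalDiscriminant v := by
  refine finprod_eq_prod_of_mulSupport_subset _ fun v hv ↦ hs ?_
  rw [Function.mem_mulSupport] at hv
  intro h0
  exact hv (by simp only [h0, pow_zero])

end Dedekind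

section Rat

open Rat.HeightOneSpectrum

/-- Over `ℤ`: the height-one prime `v` is the ideal `(p_v)` generated by the rational prime
`p_v = Rat.HeightOneSpectrum.natGenerator v` (`Rat.HeightOneSpectrum.span_natGenerator`), so its
absolute norm is `N (𝔭_v) = #(ℤ ⧸ p_v ℤ) = p_v` (`Ideal.absNorm_span_natCast`). [folklore] -/
private theorem absNorm_asIdeal_eq_natGenerator (v : HeightOneSpectrum ℤ) :
    Ideal.absNorm v.asIdeal = natGenerator v := by
  have h : v.asIdeal = Ideal.span {(natGenerator v : ℤ)} := by
    rw [span_natGenerator, ← Ideal.comap_symm]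
    ext x
    rw [Ideal.mem_comap, eq_intCast, Int.cast_id]
  rw [h, Ideal.absNorm_span_natCast, Module.finrank_self, pow_one]

/-- `Rat.HeightOneSpectrum.natGenerator : HeightOneSpectrum ℤ → ℕ` is injective: it is the first
component of the equivalence `Rat.HeightOneSpectrum.primesEquiv` between the height-one primes of
`ℤ` and the rational primes. [folklore] -/
private theorem natGenerator_injective : Function.Injective (natGenerator (R := ℤ)) :=
  fun _ _ h ↦ primesEquiv.injective (Subtype.ext h)

variable (W : WeierstrassCurve ℚ)

/-- Over `ℤ ⊆ ℚ`: `N (𝔇_min) = ∏_{v ∈ s} p_v ^ ord_v (Δ_min)` for any finite set `s` of places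
containing those with `ord_v (Δ_min) ≠ 0` — the absolute norm is multiplicative and
`N (𝔭_v) = p_v`. Silverman, AEC VIII.8, p. 243 (definition of `𝒟_{E/K}`), read over `K = ℚ`.
[cite: SilvermanAEC2009, VIII.8 (definition of the minimal discriminant, p. 243)] -/
private theorem minimalDiscriminantNorm_eq_prod {s : Finset (HeightOneSpectrum ℤ)}
    (hs : {v : HeightOneSpectrum ℤ | W.ordMinimalDiscriminant v ≠ 0} ⊆ s) :
    W.minimalDiscriminantNorm ℤ = ∏ v ∈ s, natGenerator v ^ W.ordMinimalDiscriminant v := by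
  rw [minimalDiscriminantNorm, minimalDiscriminantIdeal_eq_prod W hs, map_prod]
  simp only [map_pow, absNorm_asIdeal_eq_natGenerator]

/-- **Discharge of `WeierstrassCurve.factorization_minimalDiscriminantNorm`.** Over `ℤ ⊆ ℚ`, for
every finite place `v` of `ℤ` the exponent of the prime `p_v = Rat.HeightOneSpectrum.natGenerator v`
in `N (𝔇_min) = |Δ_min|` is `ord_v (Δ_min)`; equivalently `|Δ_min| = ∏_p p ^ ord_p (Δ_min)`.
This is Silverman's definition of the minimal discriminant, AEC VIII.8, p. 243
(`𝒟_{E/K} = ∏_v 𝔭_v ^ {ord_v (Δ_v)}`, `Δ_v` the discriminant of a minimal equation at `v`),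
specialised to `K = ℚ`: write `N (𝔇_min) = ∏_{w ∈ s} p_w ^ ord_w (Δ_min)` over a finite set `s`
of places containing `v` and the support (finite by AEC VIII.1, Remark 1.3, or empty for `Δ = 0`
by the junk value `0`), and read off the `p_v`-adic exponent using that distinct places have
distinct primes. No `[W.IsElliptic]` hypothesis is needed.
[cite: SilvermanAEC2009, VIII.8 (definition of the minimal discriminant, p. 243)] -/
theorem factorization_minimalDiscriminantNorm_holds : W.factorization_minimalDiscriminantNorm := by
  classical
  intro v
  have hs : {v : HeightOneSpectrum ℤ | W.ordMinimalDiscriminant v ≠ 0} ⊆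
      ↑(insert v (finite_setOf_ordMinimalDiscriminant_ne_zero' W).toFinset :
        Finset (HeightOneSpectrum ℤ)) := by
    intro w hw
    simp only [Finset.coe_insert, Set.Finite.coe_toFinset]
    exact Set.mem_insert_of_mem _ hw
  rw [minimalDiscriminantNorm_eq_prod W hs,
    Nat.factorization_prod_apply fun w _ ↦ pow_ne_zero _ (prime_natGenerator w).ne_zero]
  simp only [Nat.Prime.factorization_pow (prime_natGenerator _), Finsupp.single_apply]
  rw [Finset.sum_eq_single_of_mem v (Finset.mem_insert_self _ _)
    fun w _ hwv ↦ if_neg fun h ↦ hwv (natGenerator_injective h), if_pos rfl]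

end Rat

end WeierstrassCurve
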